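import Summits.ValiantsHypothesis.ValiantsHypothesis.Theorems.LacunarySymmetroidMatrixDescartesVLawKernelThree

/-!
# `MatrixDescartes` (stmt-ValiantsHypothesis-18050), line `Lift` — the SIGNED closed window, part 1:
# entries of the compressed matrix with five companion families (the negative window `γ ∈ (0,1)` added)

HONEST FRAMING.  Cell `pub-symmetroid`, seat `val-sym-mdr-p2` (gen 3); helper `--supports` the crux
`Theses.LacunarySymmetroid.MatrixDescartes`, NO closure claim.  Part 1 of the SIGNED fan law (part 2 =
`…VLawCoreSigned.lean`, the positivity statement `core_pos₅`; law = `…FanLawFour.lean`).  Nothing here bears on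
`stub_twoSided` in general, the crux in its window, `DoorA26`/`DoorA34`, or `VP ≠ VNP`.

H-form with a factoring letter `P` (ANY real symmetric matrix — its semidefiniteness is never used by the Gram
decomposition), weight `w = (u^a)⁻¹`, and five companion families: `Q l` (opposite side, gap `b l < a`, kernel window
`γ ∈ (−1,0)`), `R m` (same side, gap `c m ∈ (a,2a)`, `γ ∈ (1,2)`), `B p` (opposite, gap `= a`, `γ = −1`), `E r` (same,
gap `= 2a`, `γ = 2`) — all entering with NONNEGATIVE second-divided-difference kernels — and the NEW family `S o` (same
side, gap `cn o ∈ (0,a)`, `γ ∈ (0,1)`, weight `(u^{cn})⁻¹ = w · u^{a − cn}`) whose kernel `[p,q,t](w·(w+σ)⁻¹) =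
−σ r_p r_q r_t` is NONPOSITIVE, so that the letter's Gram block is `(−Ŝ) · D_i D_j K₃/C` with `K₃ = ∫ ρ^{n+a} r_i r_j r_t`
(`…VLawKernelThree`): nonnegative exactly for `S o ⪯ 0`.  THIS FILE: `hform₅_eq`, `entry_offdiag₅`, `entry_diag₅`,
`rearrange₅`.  [folklore] given parts `…VLawCoreBoundary`, `…VLawKernelThree`.
-/

-- layout Summits/ValiantsHypothesis/ValiantsHypothesis forces the duplicated namespace component
set_option linter.dupNamespace false

namespace Summit.ValiantsHypothesis.ValiantsHypothesis.Theorems.LacunarySymmetroidMatrixDescartes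

open MeasureTheory Set Filter Topology Matrix Finset
open scoped BigOperators
open VLawNormalForm VLawCore VLawCoreTwo VLawCoreBoundary VLawKernelThree

namespace VLawCoreSignedEntries

variable {ι : Type*} [Fintype ι] {κ μ ν ξ η : Type*} [Fintype κ] [Fintype μ] [Fintype ν] [Fintype ξ] [Fintype η]

omit [Fintype ι] in
/-- The five-family H-form as a one-family H-form over the disjoint union of the letter families. [folklore] -/
theorem hform₅_eq (J P : Matrix ι ι ℝ) (Q : κ → Matrix ι ι ℝ) (R : μ → Matrix ι ι ℝ) (B : ν → Matrix ι ι ℝ)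
    (E : ξ → Matrix ι ι ℝ) (S : η → Matrix ι ι ℝ) (w : ℝ) (gq : κ → ℝ) (gr : μ → ℝ) (gb : ν → ℝ) (ge : ξ → ℝ)
    (gs : η → ℝ) :
    J + w • P + ∑ l, gq l • Q l + ∑ m, gr m • R m + ∑ p, gb p • B p + ∑ r, ge r • E r + ∑ o, gs o • S o
      = J + w • P + ∑ x : κ ⊕ μ ⊕ ν ⊕ ξ ⊕ η,
          (Sum.elim gq (Sum.elim gr (Sum.elim gb (Sum.elim ge gs))) x)
            • (Sum.elim Q (Sum.elim R (Sum.elim B (Sum.elim E S))) x) := by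
  rw [Fintype.sum_sum_type, Fintype.sum_sum_type, Fintype.sum_sum_type, Fintype.sum_sum_type]
  simp only [Sum.elim_inl, Sum.elim_inr]
  abel

/-- **Off-diagonal entry, five families** (the factoring letter `P` is only assumed symmetric). [folklore] -/
theorem entry_offdiag₅ {a : ℕ} (ha : 0 < a) {b n : κ → ℕ} (hnb : ∀ l, n l + b l + 1 = a) (hb : ∀ l, 0 < b l)
    {c n' b' : μ → ℕ} (hnb' : ∀ m, n' m + b' m + 1 = a) (hb' : ∀ m, 0 < b' m) (hc : ∀ m, c m + b' m = 2 * a)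
    {cn nn bn : η → ℕ} (hnbn : ∀ o, nn o + bn o + 1 = a) (hbn : ∀ o, 0 < bn o) (hcn : ∀ o, cn o + bn o = a)
    {J P : Matrix ι ι ℝ} {Q : κ → Matrix ι ι ℝ} {R : μ → Matrix ι ι ℝ} {B : ν → Matrix ι ι ℝ}
    {E : ξ → Matrix ι ι ℝ} {S : η → Matrix ι ι ℝ} (hJ : J.IsSymm) (hP : P.IsSymm)
    (hQ : ∀ l, (Q l).IsSymm) (hR : ∀ m, (R m).IsSymm) (hB : ∀ p, (B p).IsSymm) (hE : ∀ r, (E r).IsSymm)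
    (hS : ∀ o, (S o).IsSymm)
    {ui uj s : ℝ} (hui : 0 < ui) (huj : 0 < uj) (hs : 0 < s)
    (hij : ui ≠ uj) {vi vj : ι → ℝ}
    (hi : (J + (ui ^ a)⁻¹ • P + ∑ l, ui ^ (b l) • Q l + ∑ m, (ui ^ (c m))⁻¹ • R m
      + ∑ p, ui ^ a • B p + ∑ r, ((ui ^ a) ^ 2)⁻¹ • E r + ∑ o, (ui ^ (cn o))⁻¹ • S o) *ᵥ vi = 0)
    (hj : (J + (uj ^ a)⁻¹ • P + ∑ l, uj ^ (b l) • Q l + ∑ m, (uj ^ (c m))⁻¹ • R m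
      + ∑ p, uj ^ a • B p + ∑ r, ((uj ^ a) ^ 2)⁻¹ • E r + ∑ o, (uj ^ (cn o))⁻¹ • S o) *ᵥ vj = 0) :
    vi ⬝ᵥ ((J + (s ^ a)⁻¹ • P + ∑ l, s ^ (b l) • Q l + ∑ m, (s ^ (c m))⁻¹ • R m
      + ∑ p, s ^ a • B p + ∑ r, ((s ^ a) ^ 2)⁻¹ • E r + ∑ o, (s ^ (cn o))⁻¹ • S o) *ᵥ vj)
      = (∑ l, (vi ⬝ᵥ (Q l *ᵥ vj)) * (((s ^ a)⁻¹ - (ui ^ a)⁻¹) * ((s ^ a)⁻¹ - (uj ^ a)⁻¹)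
          * (∫ ρ in Ioi (0:ℝ), ρ ^ (n l) / ((ui ^ a)⁻¹ + ρ ^ a) * (((uj ^ a)⁻¹ + ρ ^ a)⁻¹ * ((s ^ a)⁻¹ + ρ ^ a)⁻¹))
          / ∫ ρ in Ioi (0:ℝ), ρ ^ (n l) / (1 + ρ ^ a)))
        + (∑ m, (vi ⬝ᵥ (R m *ᵥ vj)) * (((s ^ a)⁻¹ - (ui ^ a)⁻¹) * ((s ^ a)⁻¹ - (uj ^ a)⁻¹)
          * (∫ ρ in Ioi (0:ℝ), ρ ^ (n' m) / ((s ^ a)⁻¹ + ρ ^ a)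
              * ((ρ ^ a * ((ui ^ a)⁻¹ + ρ ^ a)⁻¹) * (ρ ^ a * ((uj ^ a)⁻¹ + ρ ^ a)⁻¹)))
          / ∫ ρ in Ioi (0:ℝ), ρ ^ (n' m) / (1 + ρ ^ a)))
        + (∑ p, (vi ⬝ᵥ (B p *ᵥ vj)) * (((s ^ a)⁻¹ - (ui ^ a)⁻¹) * ((s ^ a)⁻¹ - (uj ^ a)⁻¹)
          * (ui ^ a * uj ^ a * s ^ a)))
        + (∑ r, (vi ⬝ᵥ (E r *ᵥ vj)) * (((s ^ a)⁻¹ - (ui ^ a)⁻¹) * ((s ^ a)⁻¹ - (uj ^ a)⁻¹)))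
        + ∑ o, (vi ⬝ᵥ ((-S o) *ᵥ vj)) * (((s ^ a)⁻¹ - (ui ^ a)⁻¹) * ((s ^ a)⁻¹ - (uj ^ a)⁻¹)
          * (∫ ρ in Ioi (0:ℝ), ρ ^ (nn o) / ((s ^ a)⁻¹ + ρ ^ a)
              * ((ρ ^ a * ((ui ^ a)⁻¹ + ρ ^ a)⁻¹) * ((uj ^ a)⁻¹ + ρ ^ a)⁻¹))
          / ∫ ρ in Ioi (0:ℝ), ρ ^ (nn o) / (1 + ρ ^ a)) := by
  have hna : ∀ l, n l + 2 ≤ a := fun l => by have := hnb l; have := hb l; omega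
  have hna' : ∀ m, n' m + 2 ≤ a := fun m => by have := hnb' m; have := hb' m; omega
  have hnan : ∀ o, nn o + 2 ≤ a := fun o => by have := hnbn o; have := hbn o; omega
  have hC : ∀ l, (∫ ρ in Ioi (0:ℝ), ρ ^ (n l) / (1 + ρ ^ a)) ≠ 0 :=
    fun l => (VLawStieltjes.stieltjesConst_pos (hna l)).ne'
  have hC' : ∀ m, (∫ ρ in Ioi (0:ℝ), ρ ^ (n' m) / (1 + ρ ^ a)) ≠ 0 :=
    fun m => (VLawStieltjes.stieltjesConst_pos (hna' m)).ne'
  have hCn : ∀ o, (∫ ρ in Ioi (0:ℝ), ρ ^ (nn o) / (1 + ρ ^ a)) ≠ 0 :=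
    fun o => (VLawStieltjes.stieltjesConst_pos (hnan o)).ne'
  have hpq : (uj ^ a)⁻¹ - (ui ^ a)⁻¹ ≠ 0 := by
    intro h
    exact hij ((pow_left_inj₀ hui.le huj.le ha.ne').1 (inv_injective (sub_eq_zero.1 h).symm))
  rw [hform₅_eq] at hi hj
  rw [hform₅_eq]
  have hsymm : ∀ x : κ ⊕ μ ⊕ ν ⊕ ξ ⊕ η, (Sum.elim Q (Sum.elim R (Sum.elim B (Sum.elim E S))) x).IsSymm := by
    intro x
    rcases x with l | m | p | r | o
    · exact hQ l
    · exact hR m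
    · exact hB p
    · exact hE r
    · exact hS o
  have hoff := offdiag_identity (κ := κ ⊕ μ ⊕ ν ⊕ ξ ⊕ η) hJ hP hsymm
    (ui ^ a)⁻¹ (uj ^ a)⁻¹ (s ^ a)⁻¹
    (Sum.elim (fun l => ui ^ (b l)) (Sum.elim (fun m => (ui ^ (c m))⁻¹)
      (Sum.elim (fun _ => ui ^ a) (Sum.elim (fun _ => ((ui ^ a) ^ 2)⁻¹) (fun o => (ui ^ (cn o))⁻¹)))))
    (Sum.elim (fun l => uj ^ (b l)) (Sum.elim (fun m => (uj ^ (c m))⁻¹)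
      (Sum.elim (fun _ => uj ^ a) (Sum.elim (fun _ => ((uj ^ a) ^ 2)⁻¹) (fun o => (uj ^ (cn o))⁻¹)))))
    (Sum.elim (fun l => s ^ (b l)) (Sum.elim (fun m => (s ^ (c m))⁻¹)
      (Sum.elim (fun _ => s ^ a) (Sum.elim (fun _ => ((s ^ a) ^ 2)⁻¹) (fun o => (s ^ (cn o))⁻¹))))) hi hj
  refine mul_left_cancel₀ hpq ?_
  rw [hoff, Fintype.sum_sum_type, Fintype.sum_sum_type, Fintype.sum_sum_type, Fintype.sum_sum_type]
  simp only [Sum.elim_inl, Sum.elim_inr]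
  -- the five families, letter by letter
  have eQ : ∀ l, (vi ⬝ᵥ (Q l *ᵥ vj)) * (((s ^ a)⁻¹ - (uj ^ a)⁻¹) * ui ^ (b l)
        - ((s ^ a)⁻¹ - (ui ^ a)⁻¹) * uj ^ (b l) + ((uj ^ a)⁻¹ - (ui ^ a)⁻¹) * s ^ (b l))
      = ((uj ^ a)⁻¹ - (ui ^ a)⁻¹) * ((vi ⬝ᵥ (Q l *ᵥ vj)) * (((s ^ a)⁻¹ - (ui ^ a)⁻¹) * ((s ^ a)⁻¹ - (uj ^ a)⁻¹)
          * (∫ ρ in Ioi (0:ℝ), ρ ^ (n l) / ((ui ^ a)⁻¹ + ρ ^ a) * (((uj ^ a)⁻¹ + ρ ^ a)⁻¹ * ((s ^ a)⁻¹ + ρ ^ a)⁻¹))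
          / ∫ ρ in Ioi (0:ℝ), ρ ^ (n l) / (1 + ρ ^ a))) := by
    intro l
    have hl := offdiag_integral (hna l) (inv_pos.2 (pow_pos hui a)) (inv_pos.2 (pow_pos huj a))
      (inv_pos.2 (pow_pos hs a)) (VLawStieltjes.integral_stieltjes_one (hnb l) hui)
      (VLawStieltjes.integral_stieltjes_one (hnb l) huj) (VLawStieltjes.integral_stieltjes_one (hnb l) hs)
    set Kl := ∫ ρ in Ioi (0:ℝ), ρ ^ (n l) / ((ui ^ a)⁻¹ + ρ ^ a) * (((uj ^ a)⁻¹ + ρ ^ a)⁻¹ * ((s ^ a)⁻¹ + ρ ^ a)⁻¹)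
      with hKl
    set Cl := ∫ ρ in Ioi (0:ℝ), ρ ^ (n l) / (1 + ρ ^ a) with hCl
    have hCl' : Cl ≠ 0 := hC l
    simp only [mul_div_assoc']
    rw [eq_div_iff hCl']
    linear_combination (-(vi ⬝ᵥ (Q l *ᵥ vj))) * hl
  have eR : ∀ m, (vi ⬝ᵥ (R m *ᵥ vj)) * (((s ^ a)⁻¹ - (uj ^ a)⁻¹) * (ui ^ (c m))⁻¹
        - ((s ^ a)⁻¹ - (ui ^ a)⁻¹) * (uj ^ (c m))⁻¹ + ((uj ^ a)⁻¹ - (ui ^ a)⁻¹) * (s ^ (c m))⁻¹)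
      = ((uj ^ a)⁻¹ - (ui ^ a)⁻¹) * ((vi ⬝ᵥ (R m *ᵥ vj)) * (((s ^ a)⁻¹ - (ui ^ a)⁻¹) * ((s ^ a)⁻¹ - (uj ^ a)⁻¹)
          * (∫ ρ in Ioi (0:ℝ), ρ ^ (n' m) / ((s ^ a)⁻¹ + ρ ^ a)
              * ((ρ ^ a * ((ui ^ a)⁻¹ + ρ ^ a)⁻¹) * (ρ ^ a * ((uj ^ a)⁻¹ + ρ ^ a)⁻¹)))
          / ∫ ρ in Ioi (0:ℝ), ρ ^ (n' m) / (1 + ρ ^ a))) := by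
    intro m
    have hl := offdiag_integral₂ (hna' m) (inv_pos.2 (pow_pos hui a)) (inv_pos.2 (pow_pos huj a))
      (inv_pos.2 (pow_pos hs a)) (VLawStieltjes.integral_stieltjes_one (hnb' m) hui)
      (VLawStieltjes.integral_stieltjes_one (hnb' m) huj) (VLawStieltjes.integral_stieltjes_one (hnb' m) hs)
    rw [(sameSide_pow ha (hc m) hui).1, (sameSide_pow ha (hc m) huj).1, (sameSide_pow ha (hc m) hs).1] at hl
    set Km := ∫ ρ in Ioi (0:ℝ), ρ ^ (n' m) / ((s ^ a)⁻¹ + ρ ^ a)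
        * ((ρ ^ a * ((ui ^ a)⁻¹ + ρ ^ a)⁻¹) * (ρ ^ a * ((uj ^ a)⁻¹ + ρ ^ a)⁻¹)) with hKm
    set Cm := ∫ ρ in Ioi (0:ℝ), ρ ^ (n' m) / (1 + ρ ^ a) with hCm
    have hCm' : Cm ≠ 0 := hC' m
    simp only [mul_div_assoc']
    rw [eq_div_iff hCm']
    linear_combination (-(vi ⬝ᵥ (R m *ᵥ vj))) * hl
  have eB : ∀ p, (vi ⬝ᵥ (B p *ᵥ vj)) * (((s ^ a)⁻¹ - (uj ^ a)⁻¹) * ui ^ a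
        - ((s ^ a)⁻¹ - (ui ^ a)⁻¹) * uj ^ a + ((uj ^ a)⁻¹ - (ui ^ a)⁻¹) * s ^ a)
      = ((uj ^ a)⁻¹ - (ui ^ a)⁻¹) * ((vi ⬝ᵥ (B p *ᵥ vj)) * (((s ^ a)⁻¹ - (ui ^ a)⁻¹) * ((s ^ a)⁻¹ - (uj ^ a)⁻¹)
          * (ui ^ a * uj ^ a * s ^ a))) := by
    intro p
    have hl := offdiag_inv (boundary_pow a ui).1 (boundary_pow a uj).1 (boundary_pow a s).1
      (inv_ne_zero (pow_pos hui a).ne') (inv_ne_zero (pow_pos huj a).ne') (inv_ne_zero (pow_pos hs a).ne')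
    linear_combination (vi ⬝ᵥ (B p *ᵥ vj)) * hl
  have eE : ∀ r, (vi ⬝ᵥ (E r *ᵥ vj)) * (((s ^ a)⁻¹ - (uj ^ a)⁻¹) * ((ui ^ a) ^ 2)⁻¹
        - ((s ^ a)⁻¹ - (ui ^ a)⁻¹) * ((uj ^ a) ^ 2)⁻¹ + ((uj ^ a)⁻¹ - (ui ^ a)⁻¹) * ((s ^ a) ^ 2)⁻¹)
      = ((uj ^ a)⁻¹ - (ui ^ a)⁻¹) * ((vi ⬝ᵥ (E r *ᵥ vj))
          * (((s ^ a)⁻¹ - (ui ^ a)⁻¹) * ((s ^ a)⁻¹ - (uj ^ a)⁻¹))) := by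
    intro r
    rw [(boundary_pow a ui).2, (boundary_pow a uj).2, (boundary_pow a s).2]
    have hl := offdiag_sq (ui ^ a)⁻¹ (uj ^ a)⁻¹ (s ^ a)⁻¹
    linear_combination (vi ⬝ᵥ (E r *ᵥ vj)) * hl
  have eS : ∀ o, (vi ⬝ᵥ (S o *ᵥ vj)) * (((s ^ a)⁻¹ - (uj ^ a)⁻¹) * (ui ^ (cn o))⁻¹
        - ((s ^ a)⁻¹ - (ui ^ a)⁻¹) * (uj ^ (cn o))⁻¹ + ((uj ^ a)⁻¹ - (ui ^ a)⁻¹) * (s ^ (cn o))⁻¹)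
      = ((uj ^ a)⁻¹ - (ui ^ a)⁻¹) * ((vi ⬝ᵥ ((-S o) *ᵥ vj))
          * (((s ^ a)⁻¹ - (ui ^ a)⁻¹) * ((s ^ a)⁻¹ - (uj ^ a)⁻¹)
          * (∫ ρ in Ioi (0:ℝ), ρ ^ (nn o) / ((s ^ a)⁻¹ + ρ ^ a)
              * ((ρ ^ a * ((ui ^ a)⁻¹ + ρ ^ a)⁻¹) * ((uj ^ a)⁻¹ + ρ ^ a)⁻¹))
          / ∫ ρ in Ioi (0:ℝ), ρ ^ (nn o) / (1 + ρ ^ a))) := by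
    intro o
    have hl := offdiag_integral₃ (hnan o) (inv_pos.2 (pow_pos hui a)) (inv_pos.2 (pow_pos huj a))
      (inv_pos.2 (pow_pos hs a)) (VLawStieltjes.integral_stieltjes_one (hnbn o) hui)
      (VLawStieltjes.integral_stieltjes_one (hnbn o) huj) (VLawStieltjes.integral_stieltjes_one (hnbn o) hs)
    rw [(signed_pow ha (hcn o) hui).1, (signed_pow ha (hcn o) huj).1, (signed_pow ha (hcn o) hs).1] at hl
    set Ko := ∫ ρ in Ioi (0:ℝ), ρ ^ (nn o) / ((s ^ a)⁻¹ + ρ ^ a)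
        * ((ρ ^ a * ((ui ^ a)⁻¹ + ρ ^ a)⁻¹) * ((uj ^ a)⁻¹ + ρ ^ a)⁻¹) with hKo
    set Co := ∫ ρ in Ioi (0:ℝ), ρ ^ (nn o) / (1 + ρ ^ a) with hCo
    have hCo' : Co ≠ 0 := hCn o
    rw [neg_mulVec, dotProduct_neg]
    simp only [mul_div_assoc']
    rw [eq_div_iff hCo']
    linear_combination (vi ⬝ᵥ (S o *ᵥ vj)) * hl
  simp_rw [eQ, eR, eB, eE, eS, ← Finset.mul_sum]
  ring

/-- **Diagonal entry, five families.**  Kernel blocks as off the diagonal, plus the slack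
`D_i · (P̂ − ∑ (b/a) u^{a+b} Q̂ + ∑ (c/a) u^a (u^c)⁻¹ R̂ − ∑ (u^a)^2 B̂ + ∑ 2 (u^a)⁻¹ Ê + ∑ (cn/a) u^a (u^{cn})⁻¹ Ŝ)`.
[folklore] -/
theorem entry_diag₅ {a : ℕ} (ha : 0 < a) {b n : κ → ℕ} (hnb : ∀ l, n l + b l + 1 = a) (hb : ∀ l, 0 < b l)
    {c n' b' : μ → ℕ} (hnb' : ∀ m, n' m + b' m + 1 = a) (hb' : ∀ m, 0 < b' m) (hc : ∀ m, c m + b' m = 2 * a)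
    {cn nn bn : η → ℕ} (hnbn : ∀ o, nn o + bn o + 1 = a) (hbn : ∀ o, 0 < bn o) (hcn : ∀ o, cn o + bn o = a)
    (J P : Matrix ι ι ℝ) (Q : κ → Matrix ι ι ℝ) (R : μ → Matrix ι ι ℝ) (B : ν → Matrix ι ι ℝ)
    (E : ξ → Matrix ι ι ℝ) (S : η → Matrix ι ι ℝ) {ui s : ℝ} (hui : 0 < ui) (hs : 0 < s) {vi : ι → ℝ}
    (hi : (J + (ui ^ a)⁻¹ • P + ∑ l, ui ^ (b l) • Q l + ∑ m, (ui ^ (c m))⁻¹ • R m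
      + ∑ p, ui ^ a • B p + ∑ r, ((ui ^ a) ^ 2)⁻¹ • E r + ∑ o, (ui ^ (cn o))⁻¹ • S o) *ᵥ vi = 0) :
    vi ⬝ᵥ ((J + (s ^ a)⁻¹ • P + ∑ l, s ^ (b l) • Q l + ∑ m, (s ^ (c m))⁻¹ • R m
      + ∑ p, s ^ a • B p + ∑ r, ((s ^ a) ^ 2)⁻¹ • E r + ∑ o, (s ^ (cn o))⁻¹ • S o) *ᵥ vi)
      = (∑ l, (vi ⬝ᵥ (Q l *ᵥ vi)) * (((s ^ a)⁻¹ - (ui ^ a)⁻¹) * ((s ^ a)⁻¹ - (ui ^ a)⁻¹)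
          * (∫ ρ in Ioi (0:ℝ), ρ ^ (n l) / ((ui ^ a)⁻¹ + ρ ^ a) * (((ui ^ a)⁻¹ + ρ ^ a)⁻¹ * ((s ^ a)⁻¹ + ρ ^ a)⁻¹))
          / ∫ ρ in Ioi (0:ℝ), ρ ^ (n l) / (1 + ρ ^ a)))
        + (∑ m, (vi ⬝ᵥ (R m *ᵥ vi)) * (((s ^ a)⁻¹ - (ui ^ a)⁻¹) * ((s ^ a)⁻¹ - (ui ^ a)⁻¹)
          * (∫ ρ in Ioi (0:ℝ), ρ ^ (n' m) / ((s ^ a)⁻¹ + ρ ^ a)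
              * ((ρ ^ a * ((ui ^ a)⁻¹ + ρ ^ a)⁻¹) * (ρ ^ a * ((ui ^ a)⁻¹ + ρ ^ a)⁻¹)))
          / ∫ ρ in Ioi (0:ℝ), ρ ^ (n' m) / (1 + ρ ^ a)))
        + (∑ p, (vi ⬝ᵥ (B p *ᵥ vi)) * (((s ^ a)⁻¹ - (ui ^ a)⁻¹) * ((s ^ a)⁻¹ - (ui ^ a)⁻¹)
          * (ui ^ a * ui ^ a * s ^ a)))
        + (∑ r, (vi ⬝ᵥ (E r *ᵥ vi)) * (((s ^ a)⁻¹ - (ui ^ a)⁻¹) * ((s ^ a)⁻¹ - (ui ^ a)⁻¹)))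
        + (∑ o, (vi ⬝ᵥ ((-S o) *ᵥ vi)) * (((s ^ a)⁻¹ - (ui ^ a)⁻¹) * ((s ^ a)⁻¹ - (ui ^ a)⁻¹)
          * (∫ ρ in Ioi (0:ℝ), ρ ^ (nn o) / ((s ^ a)⁻¹ + ρ ^ a)
              * ((ρ ^ a * ((ui ^ a)⁻¹ + ρ ^ a)⁻¹) * ((ui ^ a)⁻¹ + ρ ^ a)⁻¹))
          / ∫ ρ in Ioi (0:ℝ), ρ ^ (nn o) / (1 + ρ ^ a)))
        + ((s ^ a)⁻¹ - (ui ^ a)⁻¹) * (vi ⬝ᵥ (P *ᵥ vi)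
            - ∑ l, ((b l : ℝ) / a) * ui ^ (a + b l) * (vi ⬝ᵥ (Q l *ᵥ vi))
            + ∑ m, ((c m : ℝ) / a) * ui ^ a * (ui ^ (c m))⁻¹ * (vi ⬝ᵥ (R m *ᵥ vi))
            - ∑ p, (ui ^ a) ^ 2 * (vi ⬝ᵥ (B p *ᵥ vi))
            + ∑ r, 2 * (ui ^ a)⁻¹ * (vi ⬝ᵥ (E r *ᵥ vi))
            + ∑ o, ((cn o : ℝ) / a) * ui ^ a * (ui ^ (cn o))⁻¹ * (vi ⬝ᵥ (S o *ᵥ vi))) := by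
  have hna : ∀ l, n l + 2 ≤ a := fun l => by have := hnb l; have := hb l; omega
  have hna' : ∀ m, n' m + 2 ≤ a := fun m => by have := hnb' m; have := hb' m; omega
  have hnan : ∀ o, nn o + 2 ≤ a := fun o => by have := hnbn o; have := hbn o; omega
  have hC : ∀ l, (∫ ρ in Ioi (0:ℝ), ρ ^ (n l) / (1 + ρ ^ a)) ≠ 0 :=
    fun l => (VLawStieltjes.stieltjesConst_pos (hna l)).ne'
  have hC' : ∀ m, (∫ ρ in Ioi (0:ℝ), ρ ^ (n' m) / (1 + ρ ^ a)) ≠ 0 :=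
    fun m => (VLawStieltjes.stieltjesConst_pos (hna' m)).ne'
  have hCn : ∀ o, (∫ ρ in Ioi (0:ℝ), ρ ^ (nn o) / (1 + ρ ^ a)) ≠ 0 :=
    fun o => (VLawStieltjes.stieltjesConst_pos (hnan o)).ne'
  rw [hform₅_eq] at hi
  rw [hform₅_eq, diag_identity (κ := κ ⊕ μ ⊕ ν ⊕ ξ ⊕ η) J P _ (ui ^ a)⁻¹ (s ^ a)⁻¹ _
    (Sum.elim (fun l => s ^ (b l)) (Sum.elim (fun m => (s ^ (c m))⁻¹)
      (Sum.elim (fun _ => s ^ a) (Sum.elim (fun _ => ((s ^ a) ^ 2)⁻¹) (fun o => (s ^ (cn o))⁻¹))))) hi,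
    Fintype.sum_sum_type, Fintype.sum_sum_type, Fintype.sum_sum_type, Fintype.sum_sum_type]
  simp only [Sum.elim_inl, Sum.elim_inr]
  have hK : ∀ l, ((s ^ a)⁻¹ - (ui ^ a)⁻¹) * ((s ^ a)⁻¹ - (ui ^ a)⁻¹)
      * (∫ ρ in Ioi (0:ℝ), ρ ^ (n l) / ((ui ^ a)⁻¹ + ρ ^ a) * (((ui ^ a)⁻¹ + ρ ^ a)⁻¹ * ((s ^ a)⁻¹ + ρ ^ a)⁻¹))
      / (∫ ρ in Ioi (0:ℝ), ρ ^ (n l) / (1 + ρ ^ a))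
      = s ^ (b l) - ui ^ (b l) + ((s ^ a)⁻¹ - (ui ^ a)⁻¹) * (((b l : ℝ) / a) * ui ^ (a + b l)) := by
    intro l
    have hl := diag_integral (hna l) (inv_pos.2 (pow_pos hui a)) (inv_pos.2 (pow_pos hs a))
      (VLawStieltjes.integral_stieltjes_one (hnb l) hui) (VLawStieltjes.integral_stieltjes_one (hnb l) hs)
      (VLawStieltjes.integral_stieltjes_sq (hnb l) (hb l) hui)
    set Kl := ∫ ρ in Ioi (0:ℝ), ρ ^ (n l) / ((ui ^ a)⁻¹ + ρ ^ a) * (((ui ^ a)⁻¹ + ρ ^ a)⁻¹ * ((s ^ a)⁻¹ + ρ ^ a)⁻¹)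
      with hKl
    set Cl := ∫ ρ in Ioi (0:ℝ), ρ ^ (n l) / (1 + ρ ^ a) with hCl
    have hCl' : Cl ≠ 0 := hC l
    rw [div_eq_iff hCl']
    linear_combination hl
  have hK' : ∀ m, ((s ^ a)⁻¹ - (ui ^ a)⁻¹) * ((s ^ a)⁻¹ - (ui ^ a)⁻¹)
      * (∫ ρ in Ioi (0:ℝ), ρ ^ (n' m) / ((s ^ a)⁻¹ + ρ ^ a)
          * ((ρ ^ a * ((ui ^ a)⁻¹ + ρ ^ a)⁻¹) * (ρ ^ a * ((ui ^ a)⁻¹ + ρ ^ a)⁻¹)))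
      / (∫ ρ in Ioi (0:ℝ), ρ ^ (n' m) / (1 + ρ ^ a))
      = (s ^ (c m))⁻¹ - (ui ^ (c m))⁻¹
        - ((s ^ a)⁻¹ - (ui ^ a)⁻¹) * (((c m : ℝ) / a) * ui ^ a * (ui ^ (c m))⁻¹) := by
    intro m
    have hl := diag_integral₂ (hna' m) (inv_pos.2 (pow_pos hui a)) (inv_pos.2 (pow_pos hs a))
      (VLawStieltjes.integral_stieltjes_one (hnb' m) hui) (VLawStieltjes.integral_stieltjes_one (hnb' m) hs)
      (VLawStieltjes.integral_stieltjes_sq (hnb' m) (hb' m) hui)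
    rw [(sameSide_pow ha (hc m) hui).1, (sameSide_pow ha (hc m) hs).1, (sameSide_pow ha (hc m) hui).2] at hl
    set Km := ∫ ρ in Ioi (0:ℝ), ρ ^ (n' m) / ((s ^ a)⁻¹ + ρ ^ a)
        * ((ρ ^ a * ((ui ^ a)⁻¹ + ρ ^ a)⁻¹) * (ρ ^ a * ((ui ^ a)⁻¹ + ρ ^ a)⁻¹)) with hKm
    set Cm := ∫ ρ in Ioi (0:ℝ), ρ ^ (n' m) / (1 + ρ ^ a) with hCm
    have hCm' : Cm ≠ 0 := hC' m
    rw [div_eq_iff hCm']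
    linear_combination hl
  have hKB : ((s ^ a)⁻¹ - (ui ^ a)⁻¹) * ((s ^ a)⁻¹ - (ui ^ a)⁻¹) * (ui ^ a * ui ^ a * s ^ a)
      = s ^ a - ui ^ a + ((s ^ a)⁻¹ - (ui ^ a)⁻¹) * (ui ^ a) ^ 2 := by
    have hl := diag_inv (boundary_pow a ui).1 (boundary_pow a s).1
      (inv_ne_zero (pow_pos hui a).ne') (inv_ne_zero (pow_pos hs a).ne')
    linear_combination (-1 : ℝ) * hl
  have hKE : ((s ^ a)⁻¹ - (ui ^ a)⁻¹) * ((s ^ a)⁻¹ - (ui ^ a)⁻¹)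
      = ((s ^ a) ^ 2)⁻¹ - ((ui ^ a) ^ 2)⁻¹ - ((s ^ a)⁻¹ - (ui ^ a)⁻¹) * (2 * (ui ^ a)⁻¹) := by
    rw [(boundary_pow a ui).2, (boundary_pow a s).2]
    have hl := diag_sq (ui ^ a)⁻¹ (s ^ a)⁻¹
    linear_combination (-1 : ℝ) * hl
  have hKS : ∀ o, ((s ^ a)⁻¹ - (ui ^ a)⁻¹) * ((s ^ a)⁻¹ - (ui ^ a)⁻¹)
      * (∫ ρ in Ioi (0:ℝ), ρ ^ (nn o) / ((s ^ a)⁻¹ + ρ ^ a)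
          * ((ρ ^ a * ((ui ^ a)⁻¹ + ρ ^ a)⁻¹) * ((ui ^ a)⁻¹ + ρ ^ a)⁻¹))
      / (∫ ρ in Ioi (0:ℝ), ρ ^ (nn o) / (1 + ρ ^ a))
      = -((s ^ (cn o))⁻¹ - (ui ^ (cn o))⁻¹)
        + ((s ^ a)⁻¹ - (ui ^ a)⁻¹) * (((cn o : ℝ) / a) * ui ^ a * (ui ^ (cn o))⁻¹) := by
    intro o
    have hl := diag_integral₃ (hnan o) (inv_pos.2 (pow_pos hui a)) (inv_pos.2 (pow_pos hs a))
      (VLawStieltjes.integral_stieltjes_one (hnbn o) hui) (VLawStieltjes.integral_stieltjes_one (hnbn o) hs)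
      (VLawStieltjes.integral_stieltjes_sq (hnbn o) (hbn o) hui)
    rw [(signed_pow ha (hcn o) hui).1, (signed_pow ha (hcn o) hs).1, (signed_pow ha (hcn o) hui).2] at hl
    set Ko := ∫ ρ in Ioi (0:ℝ), ρ ^ (nn o) / ((s ^ a)⁻¹ + ρ ^ a)
        * ((ρ ^ a * ((ui ^ a)⁻¹ + ρ ^ a)⁻¹) * ((ui ^ a)⁻¹ + ρ ^ a)⁻¹) with hKo
    set Co := ∫ ρ in Ioi (0:ℝ), ρ ^ (nn o) / (1 + ρ ^ a) with hCo
    have hCo' : Co ≠ 0 := hCn o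
    rw [div_eq_iff hCo']
    linear_combination hl
  simp_rw [hK, hK', hKB, hKS, hKE]
  have e1 : ∑ l, (vi ⬝ᵥ (Q l *ᵥ vi)) * (s ^ (b l) - ui ^ (b l)
        + ((s ^ a)⁻¹ - (ui ^ a)⁻¹) * (((b l : ℝ) / a) * ui ^ (a + b l)))
      = ∑ l, (s ^ (b l) - ui ^ (b l)) * (vi ⬝ᵥ (Q l *ᵥ vi))
        + ((s ^ a)⁻¹ - (ui ^ a)⁻¹) * ∑ l, ((b l : ℝ) / a) * ui ^ (a + b l) * (vi ⬝ᵥ (Q l *ᵥ vi)) := by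
    rw [Finset.mul_sum, ← Finset.sum_add_distrib]
    exact Finset.sum_congr rfl fun l _ => by ring
  have e2 : ∑ m, (vi ⬝ᵥ (R m *ᵥ vi)) * ((s ^ (c m))⁻¹ - (ui ^ (c m))⁻¹
        - ((s ^ a)⁻¹ - (ui ^ a)⁻¹) * (((c m : ℝ) / a) * ui ^ a * (ui ^ (c m))⁻¹))
      = ∑ m, ((s ^ (c m))⁻¹ - (ui ^ (c m))⁻¹) * (vi ⬝ᵥ (R m *ᵥ vi))
        - ((s ^ a)⁻¹ - (ui ^ a)⁻¹) * ∑ m, ((c m : ℝ) / a) * ui ^ a * (ui ^ (c m))⁻¹ * (vi ⬝ᵥ (R m *ᵥ vi)) := by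
    rw [Finset.mul_sum, ← Finset.sum_sub_distrib]
    exact Finset.sum_congr rfl fun m _ => by ring
  have e3 : ∑ p, (vi ⬝ᵥ (B p *ᵥ vi)) * (s ^ a - ui ^ a + ((s ^ a)⁻¹ - (ui ^ a)⁻¹) * (ui ^ a) ^ 2)
      = ∑ p, (s ^ a - ui ^ a) * (vi ⬝ᵥ (B p *ᵥ vi))
        + ((s ^ a)⁻¹ - (ui ^ a)⁻¹) * ∑ p, (ui ^ a) ^ 2 * (vi ⬝ᵥ (B p *ᵥ vi)) := by
    rw [Finset.mul_sum, ← Finset.sum_add_distrib]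
    exact Finset.sum_congr rfl fun p _ => by ring
  have e4 : ∑ r, (vi ⬝ᵥ (E r *ᵥ vi)) * (((s ^ a) ^ 2)⁻¹ - ((ui ^ a) ^ 2)⁻¹
        - ((s ^ a)⁻¹ - (ui ^ a)⁻¹) * (2 * (ui ^ a)⁻¹))
      = ∑ r, (((s ^ a) ^ 2)⁻¹ - ((ui ^ a) ^ 2)⁻¹) * (vi ⬝ᵥ (E r *ᵥ vi))
        - ((s ^ a)⁻¹ - (ui ^ a)⁻¹) * ∑ r, 2 * (ui ^ a)⁻¹ * (vi ⬝ᵥ (E r *ᵥ vi)) := by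
    rw [Finset.mul_sum, ← Finset.sum_sub_distrib]
    exact Finset.sum_congr rfl fun r _ => by ring
  have e5 : ∑ o, (vi ⬝ᵥ ((-S o) *ᵥ vi)) * (-((s ^ (cn o))⁻¹ - (ui ^ (cn o))⁻¹)
        + ((s ^ a)⁻¹ - (ui ^ a)⁻¹) * (((cn o : ℝ) / a) * ui ^ a * (ui ^ (cn o))⁻¹))
      = ∑ o, ((s ^ (cn o))⁻¹ - (ui ^ (cn o))⁻¹) * (vi ⬝ᵥ (S o *ᵥ vi))
        - ((s ^ a)⁻¹ - (ui ^ a)⁻¹) * ∑ o, ((cn o : ℝ) / a) * ui ^ a * (ui ^ (cn o))⁻¹ * (vi ⬝ᵥ (S o *ᵥ vi)) := by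
    rw [Finset.mul_sum, ← Finset.sum_sub_distrib]
    exact Finset.sum_congr rfl fun o _ => by rw [neg_mulVec, dotProduct_neg]; ring
  rw [e1, e2, e3, e4, e5]
  ring

/-- Rearrangement of the double sum with five letter families (pure bookkeeping). [folklore] -/
theorem rearrange₅ {k : ℕ} (cc D sl : Fin k → ℝ) (Qh KQ : κ → Fin k → Fin k → ℝ) (CQ : κ → ℝ)
    (Rh KR : μ → Fin k → Fin k → ℝ) (CR : μ → ℝ) (Bh : ν → Fin k → Fin k → ℝ) (W : Fin k → ℝ) (t : ℝ)
    (Eh : ξ → Fin k → Fin k → ℝ) (Sh KS : η → Fin k → Fin k → ℝ) (CS : η → ℝ) :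
    ∑ i, ∑ j, cc i * cc j * ((∑ l, Qh l i j * (D i * D j * KQ l i j / CQ l))
        + (∑ m, Rh m i j * (D i * D j * KR m i j / CR m))
        + (∑ p, Bh p i j * (D i * D j * (W i * W j * t)))
        + (∑ r, Eh r i j * (D i * D j))
        + (∑ o, Sh o i j * (D i * D j * KS o i j / CS o))
        + if i = j then sl i else 0)
      = (∑ l, (CQ l)⁻¹ * ∑ i, ∑ j, (cc i * D i) * (cc j * D j) * Qh l i j * KQ l i j)
        + (∑ m, (CR m)⁻¹ * ∑ i, ∑ j, (cc i * D i) * (cc j * D j) * Rh m i j * KR m i j)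
        + (∑ p, t * ∑ i, ∑ j, (cc i * D i * W i) * (cc j * D j * W j) * Bh p i j)
        + (∑ r, ∑ i, ∑ j, (cc i * D i) * (cc j * D j) * Eh r i j)
        + (∑ o, (CS o)⁻¹ * ∑ i, ∑ j, (cc i * D i) * (cc j * D j) * Sh o i j * KS o i j)
        + ∑ i, cc i ^ 2 * sl i := by
  classical
  have h1 := rearrange₄ cc D sl Qh KQ CQ Rh KR CR Bh W t Eh
  have h2 := rearrange cc D (fun _ => 0) Sh KS CS
  simp only [ite_self, add_zero, mul_zero, Finset.sum_const_zero] at h2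
  have hsplit : ∀ i j, cc i * cc j * ((∑ l, Qh l i j * (D i * D j * KQ l i j / CQ l))
        + (∑ m, Rh m i j * (D i * D j * KR m i j / CR m))
        + (∑ p, Bh p i j * (D i * D j * (W i * W j * t)))
        + (∑ r, Eh r i j * (D i * D j))
        + (∑ o, Sh o i j * (D i * D j * KS o i j / CS o))
        + if i = j then sl i else 0)
      = cc i * cc j * ((∑ l, Qh l i j * (D i * D j * KQ l i j / CQ l))
        + (∑ m, Rh m i j * (D i * D j * KR m i j / CR m))
        + (∑ p, Bh p i j * (D i * D j * (W i * W j * t)))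
        + (∑ r, Eh r i j * (D i * D j))
        + if i = j then sl i else 0)
        + cc i * cc j * (∑ o, Sh o i j * (D i * D j * KS o i j / CS o)) := fun i j => by ring
  simp_rw [hsplit, Finset.sum_add_distrib]
  rw [h1, h2]
  ring

end VLawCoreSignedEntries

end Summit.ValiantsHypothesis.ValiantsHypothesis.Theorems.LacunarySymmetroidMatrixDescartes
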